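/-
Copyright (c) 2026 the pub-hodgecm-mathlib formalisation cell (harness21).  Prover seat hodgecm-mathlib-A-p19 (g28): «S3-ram» seeding wave (LEAD F0P3a-plan (g12)
T11-88∕T11-89; owner F0P3a-p06 (g15)), socket (Lit2) «TYPE-(2) v-DEEP LITERALS» of the fold v7.6 — the ANISOTROPIC (opposite-sign) literal, generic algebra; 2026-09-02.
-/
import Literature.NumberTheory.Rogawski1990.TypeTwoNonNormTwistExplicit          -- ★ p846626 (F0P3-p04): `sqrtGenerator_shape`, `typeTwo_relations_of_unitary` (the `⋆`-FIXED case of §1)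
import Literature.NumberTheory.Rogawski1990.TwoDeepRepresentativesTypeTwoLocal     -- ★ (F0P3-p04): `valued_conj_sub_one_le`, `valued_apply_le_one_of_sub_one_le` (the valued kit of §3)
import HarnessLib

/-!
# The anisotropic twist of a type-(2) unitary element in the REGULAR REPRESENTATION of its `⋆`-eigen square-root generator — the algebra of the opposite-sign
# 2-deep literal at a TAMELY RAMIFIED place (Rogawski 1990 §3.5 Prop. 3.5.2 (a)(c), §3.6; Labesse–Langlands 1979 §2)

Topic `NumberTheory/Rogawski1990`; namespace `Literature.NumberTheory.Rogawski1990`.  THEOREMS ONLY (no definition, no instance, no notation, no named fact, no `sorry`);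
generic algebra over a field `K` with a ring endomorphism `σ` (§1–§2) and over a `ℤᵐ⁰`-valued field (§3); kernel lane `--supports stmt-HodgeConjecture-24833`.  Cell
`pub/hodgecm-mathlib` (D-0151), crux H413; road «S3-ram», fold `LocalTransferAtOneTameRamified` v7.6 (fold pen F0P3-p02 (g17)), socket **(Lit2)** `stub_typeTwo_literals_{even,odd}_ram`
(the `hLit` hypothesis of ★ `typeTwo_GSideNhds_{even,odd}_ram_of_literals_of_counts`): both matched classes of a 2-deep type-(2) `γ_H` contain v-DEEP elements.  The FRAME
literal (sign `(y_λ,θ)_v`) is ★ F0P3a-p03 (g17) `TypeTwoRamifiedFrameLiteral`; this file is the algebra of the OTHER one.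
HONEST LABEL: HC_CM is proved only modulo the cell's 2 remaining named inputs (hLiu418 24832, h413 24833) until rung 0 closes; this file is unconditional matrix algebra.

THE MATHEMATICS.  `E∕F` quadratic with involution `σ`, `Φ₂ = antidiag(1,1)`, `g ∈ U(Φ₂)` of type (2) (`χ_g` rootless).  The commutant `E[g]` carries the adjoint involution `⋆`;
★ `exists_nonscalar_hermStar_eq_sq_eq_smul` gives a `⋆`-fixed non-scalar `κ = α₀ + β₀g` with `κ² = k₀`, `k₀ ∈ F` a NON-square of `E`.  At a TAMELY RAMIFIED place `k₀` has EVEN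
order `2k` and the right rescaling is by the ANTI-fixed uniformiser: `Π := ϖ^{−k}·κ` has `Π² = D·1` with `D` a σ-fixed non-square UNIT, but `Π⋆ = s₀Π`, `s₀ = (−1)^k` — so this file
carries a SIGN `s₀` (`s₀ = 1`: the `⋆`-fixed case of ★ `TypeTwoNonNormTwistExplicit`; `s₀ = −1`: the `⋆`-anti-fixed case).  With `Π = (p q; r −p)`, `p² + qr = D`:
* §1 `sqrtGenerator_shape_signed`: `σp = −s₀p`, `σq = s₀q`, `σr = s₀r`; `typeTwo_relations_of_unitary_signed`: for `g = φ₀ + φ₁Π ∈ U(Φ₂)`,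
  (R1ₛ) `σφ₀·φ₁ + s₀·σφ₁·φ₀ = 0`, (R2ₛ) `σφ₀·φ₀ + s₀D·σφ₁·φ₁ = 1`.
* §2 THE REGULAR REPRESENTATION `G₁ := (φ₀ φ₁D; φ₁ φ₀)` of `g` on the cyclic frame `C = (e₀ | Πe₀) = (1 p; 0 r)`: `g·C = C·G₁` (`literal_mul_cyclicFrame_eq`; `det C = r ≠ 0`), so
  `G₁ ∼ g` in `GL₂(E)`; and `G₁` is UNITARY for every `Ψ_{x,y} := (x, yD; s₀Dy, s₀Dx)` with `σx = x`, `σy = s₀y` (`regRep_unitary`, four polynomial identities from (R1ₛ)(R2ₛ)),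
  `det Ψ_{x,y} = s₀D(x² − Dy²)` — the invariant hermitian forms of the torus; the ANISOTROPIC class (`−det Ψ ∉ N(E^×)`) is reached with `x² − Dy² ≡ −s₀`, since then `−det Ψ ≡ D`
  is a non-square unit (consumer's choice: `(x,y) = (1,0)` if `s₀ = −1`, a residue solution of `x² − Dy² = −1` if `s₀ = 1`).  The 3 × 3 dress `H₃ = endoForm Ψ (η)`,
  `endoGL (G₁, u) ∈ U(H₃)` (`endoGL_regRep_unitary`).
* §3 VALUATIONS (`|D| = 1`, `|2| = 1`): if `g ≡ 1 (mod ϖ²)` entrywise then `|φ₀ − 1|, |φ₁| ≤ |ϖ|²` (NO level loss — contrast ★ `valued_coords_of_entrywise_deep`, where `|D| = |ϖ_v|`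
  costs one level), so `G₁ ≡ 1` and `endoGL(G₁, u) ≡ 1 (mod ϖ²)` (`valued_regRep_sub_one_le`, `valued_endoPattern_sub_one_le`).
The sequel `TwoDeepAnisotropicLiteralRamified` builds `Π`, the twist data and the integral isometry at a tame-ramified CM place and assembles the literal.

## References
* [Rogawski1990] J. D. Rogawski, *Automorphic Representations of Unitary Groups in Three Variables*, Ann. of Math. Stud. 123 (1990), §3.5 Prop. 3.5.2 (a)(c) p. 29, §3.6 p. 31,
  §4.3 (4.3.2) p. 43, §4.9 Prop. 4.9.1 p. 55.
* [LabesseLanglands1979] J.-P. Labesse, R. P. Langlands, *L-indistinguishability for SL(2)*, Canad. J. Math. 31 (1979), §2 pp. 8–10 (the anisotropic torus at a ramified place).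
* [Jacobowitz1962] R. Jacobowitz, *Hermitian forms over local fields*, Amer. J. Math. 84 (1962), §5, §7–§8.
-/

set_option autoImplicit false

namespace Literature.NumberTheory.Rogawski1990

open Matrix

section Algebra

variable {K : Type*} [Field K] (σ : K →+* K)

/-! ## §1 The signed shape of a traceless `⋆`-eigen generator and the two unitarity relations -/

/-- **Signed shape.**  If `ᵗ(σΠ)·Φ₂ = (s₀Φ₂)·Π` (`Π` is a `Φ₂`-`⋆`-eigenvector of sign `s₀`) and `tr Π = 0` then `Π = (p q; r −p)` with `σp = −s₀p`, `σq = s₀q`, `σr = s₀r`, and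
`Π² = D·1` reads `p² + qr = D` (the `⋆`-fixed case `s₀ = 1` is ★ `sqrtGenerator_shape`). [cite: Rogawski1990, §3.6 p. 31; §3.5 Prop. 3.5.2 (a) p. 29] -/
theorem sqrtGenerator_shape_signed (P : Matrix (Fin 2) (Fin 2) K) (s₀ : K)
    (hPs : (P.map σ)ᵀ * !![(0 : K), 1; 1, 0] = !![(0 : K), s₀; s₀, 0] * P) (htr : P.trace = 0)
    {D : K} (hsq : P * P = D • (1 : Matrix (Fin 2) (Fin 2) K)) :
    σ (P 0 0) = -(s₀ * P 0 0) ∧ σ (P 0 1) = s₀ * P 0 1 ∧ σ (P 1 0) = s₀ * P 1 0 ∧ P 1 1 = -P 0 0 ∧ P 0 0 * P 0 0 + P 0 1 * P 1 0 = D := by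
  have h11 : P 1 1 = -P 0 0 := by
    rw [Matrix.trace_fin_two] at htr
    linear_combination htr
  have e00 := congrArg (fun M => M 0 0) hPs
  have e01 := congrArg (fun M => M 0 1) hPs
  have e11 := congrArg (fun M => M 1 1) hPs
  have s00 := congrArg (fun M => M 0 0) hsq
  simp [Matrix.mul_apply, Fin.sum_univ_two] at e00 e01 e11 s00
  rw [h11] at e01
  exact ⟨by rw [e01]; ring, e11, e00, h11, s00⟩

/-- **The two signed unitarity relations.**  For `Π = (p q; r −p)` with `σp = −s₀p`, `σr = s₀r`, `r ≠ 0`, `p² + qr = D`, and `g = φ₀ + φ₁Π =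
(φ₀+φ₁p, φ₁q; φ₁r, φ₀−φ₁p)` unitary for `Φ₂`: (R1ₛ) `σφ₀·φ₁ + s₀·σφ₁·φ₀ = 0` and (R2ₛ) `σφ₀·φ₀ + s₀·D·(σφ₁·φ₁) = 1` (the `(0,0)` entry of `ᵗ(σg)Φ₂g = Φ₂` is `r·(R1ₛ)`,
the `(0,1)` entry is `(R2ₛ) − p·(R1ₛ) + s₀σφ₁φ₁·(p² + qr − D)`). [cite: Rogawski1990, §3.6 p. 31; §3.5 Prop. 3.5.2 (a) p. 29] -/
theorem typeTwo_relations_of_unitary_signed {p q r D φ₀ φ₁ s₀ : K} (hp : σ p = -(s₀ * p)) (hr : σ r = s₀ * r)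
    (hD : p * p + q * r = D) (hr0 : r ≠ 0)
    (hgu : ((!![φ₀ + φ₁ * p, φ₁ * q; φ₁ * r, φ₀ - φ₁ * p] : Matrix (Fin 2) (Fin 2) K).map σ)ᵀ * !![(0 : K), 1; 1, 0] *
      !![φ₀ + φ₁ * p, φ₁ * q; φ₁ * r, φ₀ - φ₁ * p] = !![(0 : K), 1; 1, 0]) :
    σ φ₀ * φ₁ + s₀ * (σ φ₁ * φ₀) = 0 ∧ σ φ₀ * φ₀ + s₀ * D * (σ φ₁ * φ₁) = 1 := by
  have e00 := congrArg (fun M => M 0 0) hgu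
  have e01 := congrArg (fun M => M 0 1) hgu
  simp [Matrix.mul_apply, Fin.sum_univ_two, map_add, map_mul, hp, hr] at e00 e01
  have R1 : σ φ₀ * φ₁ + s₀ * (σ φ₁ * φ₀) = 0 := by
    have h : r * (σ φ₀ * φ₁ + s₀ * (σ φ₁ * φ₀)) = 0 := by linear_combination e00
    rcases mul_eq_zero.1 h with h | h
    · exact absurd h hr0
    · exact h
  refine ⟨R1, ?_⟩
  linear_combination e01 + p * R1 - s₀ * (σ φ₁ * φ₁) * hD

/-! ## §2 The regular representation `G₁ = (φ₀ φ₁D; φ₁ φ₀)`: cyclic frame, invariant forms `Ψ_{x,y}`, the `3 × 3` dress -/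

/-- **THE CYCLIC FRAME**: for `Π = (p q; r −p)` with `p² + qr = D` and `g = φ₀ + φ₁Π`, `g · C = C · G₁` with `C = (e₀ | Πe₀) = (1 p; 0 r)` and `G₁ = (φ₀ φ₁D; φ₁ φ₀)` — the matrix of
`g` in the basis `(e₀, Πe₀)`, i.e. the regular representation of `φ₀ + φ₁√D` on `(1, √D)`. [cite: Rogawski1990, §3.6 p. 31] -/
theorem literal_mul_cyclicFrame_eq {p q r D φ₀ φ₁ : K} (hD : p * p + q * r = D) :
    (!![φ₀ + φ₁ * p, φ₁ * q; φ₁ * r, φ₀ - φ₁ * p] : Matrix (Fin 2) (Fin 2) K) * !![(1 : K), p; 0, r] = !![(1 : K), p; 0, r] * !![φ₀, φ₁ * D; φ₁, φ₀] := by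
  ext i j
  fin_cases i <;> fin_cases j <;> simp [Matrix.mul_apply, Fin.sum_univ_two]
  all_goals first | ring1 | linear_combination φ₁ * hD

/-- `det (1 p; 0 r) = r`. [cite: Rogawski1990, §3.6 p. 31] -/
theorem det_cyclicFrame (p r : K) : (!![(1 : K), p; 0, r] : Matrix (Fin 2) (Fin 2) K).det = r := by
  rw [Matrix.det_fin_two_of]; ring

/-- `χ`-data of the regular representation: `tr G₁ = 2φ₀`, `det G₁ = φ₀² − Dφ₁²`. [cite: Rogawski1990, §3.6 p. 31] -/
theorem det_regRep (φ₀ φ₁ D : K) : (!![φ₀, φ₁ * D; φ₁, φ₀] : Matrix (Fin 2) (Fin 2) K).det = φ₀ * φ₀ - D * (φ₁ * φ₁) := by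
  rw [Matrix.det_fin_two_of]; ring

/-- **THE INVARIANT FORMS OF THE TORUS**: with (R1ₛ), (R2ₛ), `s₀² = 1` and `σD = D`, the regular representation `G₁ = (φ₀ φ₁D; φ₁ φ₀)` preserves EVERY
`Ψ_{x,y} = (x, yD; s₀Dy, s₀Dx)` (`x, y ∈ K` arbitrary): `ᵗ(σG₁)·Ψ·G₁ = Ψ` (four polynomial identities; `Ψ_{x,y}` is hermitian when `σx = x`, `σy = s₀y` — `twistForm_hermitian`). [cite: Rogawski1990, §3.5 Prop. 3.5.2 (a)(c) p. 29; §3.6 p. 31]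
[cite: LabesseLanglands1979, §2 pp. 8–9] -/
theorem regRep_unitary {D φ₀ φ₁ s₀ : K} (x y : K) (hs : s₀ * s₀ = 1) (hσD : σ D = D)
    (R1 : σ φ₀ * φ₁ + s₀ * (σ φ₁ * φ₀) = 0) (R2 : σ φ₀ * φ₀ + s₀ * D * (σ φ₁ * φ₁) = 1) :
    ((!![φ₀, φ₁ * D; φ₁, φ₀] : Matrix (Fin 2) (Fin 2) K).map σ)ᵀ * !![x, y * D; s₀ * D * y, s₀ * D * x] * !![φ₀, φ₁ * D; φ₁, φ₀] =
      !![x, y * D; s₀ * D * y, s₀ * D * x] := by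
  ext i j
  fin_cases i <;> fin_cases j <;> simp [Matrix.mul_apply, Fin.sum_univ_two, map_mul, hσD]
  · linear_combination x * R2 + D * y * R1
  · linear_combination D * x * R1 + D * y * R2
  · linear_combination s₀ * D * x * R1 + s₀ * D * y * R2 - (D * x * σ φ₁ * φ₀ + D * D * y * σ φ₁ * φ₁) * hs
  · linear_combination s₀ * D * x * R2 + s₀ * D * D * y * R1 - (D * D * x * σ φ₁ * φ₁ + D * D * y * σ φ₁ * φ₀) * hs

/-- `det Ψ_{x,y} = s₀·D·(x² − D·y²)`. [cite: Rogawski1990, §3.5 Prop. 3.5.2 (c) p. 29] -/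
theorem det_twistForm (D s₀ x y : K) : (!![x, y * D; s₀ * D * y, s₀ * D * x] : Matrix (Fin 2) (Fin 2) K).det = s₀ * D * (x * x - D * (y * y)) := by
  rw [Matrix.det_fin_two_of]; ring

/-- `Ψ_{x,y}` is `σ`-hermitian (`σ` fixes `D, x, s₀`, `σy = s₀y`, `s₀² = 1`). [cite: Rogawski1990, §3.5 p. 29] -/
theorem twistForm_hermitian {D s₀ x y : K} (hs : s₀ * s₀ = 1) (hσD : σ D = D) (hσx : σ x = x) (hσy : σ y = s₀ * y) (hσs : σ s₀ = s₀) :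
    ((!![x, y * D; s₀ * D * y, s₀ * D * x] : Matrix (Fin 2) (Fin 2) K).map σ)ᵀ = !![x, y * D; s₀ * D * y, s₀ * D * x] := by
  ext i j
  fin_cases i <;> fin_cases j <;> simp [map_mul, hσD, hσx, hσy, hσs]
  · linear_combination (D * y) * hs
  · ring

end Algebra

/-! ## §3 Valuations: a 2-deep `g` has 2-deep coordinates when `|D| = 1` — no level is lost -/

section Valued

variable {K : Type*} [Field K] [hK : Valued K (WithZero (Multiplicative ℤ))]

/-- In a linearly ordered commutative group with zero, `a·a ≤ b·b ⇒ a ≤ b`. [cite: Serre1979, Ch. II §1] -/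
theorem le_of_mul_self_le_mul_self₀ {a b : WithZero (Multiplicative ℤ)} (h : a * a ≤ b * b) : a ≤ b := by
  by_contra hlt
  rw [not_le] at hlt
  exact absurd h (not_le.2 (mul_lt_mul'' hlt hlt zero_le zero_le))

/-- **2-DEEP COORDINATES, NO LEVEL LOSS.**  If `g = (φ₀+φ₁p, φ₁q; φ₁r, φ₀−φ₁p) ≡ 1 (mod c)` entrywise (`|(g − 1)_{ab}| ≤ |c|`), `p² + qr = D` with `|D| = 1` and `|2| = 1`, then
`|φ₀ − 1| ≤ |c|` (trace) and `|φ₁| ≤ |c|` (`φ₁²D = (φ₁p)² + (φ₁q)(φ₁r)` with `|φ₁p|, |φ₁q|, |φ₁r| ≤ |c|`). [cite: Serre1979, Ch. II §1] [cite: Rogawski1990, §3.6 p. 31] -/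
theorem valued_coords_of_entrywise_le {p q r D φ₀ φ₁ c : K} (hD : p * p + q * r = D) (hvD : Valued.v D = 1) (h2 : Valued.v (2 : K) = 1)
    (hg : ∀ a b, Valued.v (((!![φ₀ + φ₁ * p, φ₁ * q; φ₁ * r, φ₀ - φ₁ * p] : Matrix (Fin 2) (Fin 2) K) - 1) a b) ≤ Valued.v c) :
    Valued.v (φ₀ - 1) ≤ Valued.v c ∧ Valued.v φ₁ ≤ Valued.v c := by
  have h00 : Valued.v (φ₀ + φ₁ * p - 1) ≤ Valued.v c := by simpa [Matrix.sub_apply] using hg 0 0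
  have h01 : Valued.v (φ₁ * q) ≤ Valued.v c := by simpa [Matrix.sub_apply] using hg 0 1
  have h10 : Valued.v (φ₁ * r) ≤ Valued.v c := by simpa [Matrix.sub_apply] using hg 1 0
  have h11 : Valued.v (φ₀ - φ₁ * p - 1) ≤ Valued.v c := by simpa [Matrix.sub_apply] using hg 1 1
  -- trace: `2(φ₀ − 1) = (g − 1)₀₀ + (g − 1)₁₁`
  have hφ₀ : Valued.v (φ₀ - 1) ≤ Valued.v c := by
    have h20 : (2 : K) ≠ 0 := fun h => by rw [h, map_zero] at h2; exact zero_ne_one h2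
    have e : φ₀ - 1 = 2⁻¹ * ((φ₀ + φ₁ * p - 1) + (φ₀ - φ₁ * p - 1)) := by
      field_simp; ring
    rw [e, Valuation.map_mul, map_inv₀, h2, inv_one, one_mul]
    exact (Valuation.map_add _ _ _).trans (max_le h00 h11)
  refine ⟨hφ₀, ?_⟩
  -- `φ₁ p = (g − 1)₀₀ − (φ₀ − 1)`
  have hφp : Valued.v (φ₁ * p) ≤ Valued.v c := by
    have e : φ₁ * p = (φ₀ + φ₁ * p - 1) - (φ₀ - 1) := by ring
    rw [e]; exact (Valuation.map_sub _ _ _).trans (max_le h00 hφ₀)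
  -- `φ₁² D = (φ₁p)² + (φ₁q)(φ₁r)`
  have hsq : Valued.v φ₁ * Valued.v φ₁ ≤ Valued.v c * Valued.v c := by
    have e : φ₁ * φ₁ * D = (φ₁ * p) * (φ₁ * p) + (φ₁ * q) * (φ₁ * r) := by rw [← hD]; ring
    have h : Valued.v (φ₁ * φ₁ * D) ≤ Valued.v c * Valued.v c := by
      rw [e]
      refine (Valuation.map_add _ _ _).trans (max_le ?_ ?_)
      · rw [Valuation.map_mul]; exact mul_le_mul' hφp hφp
      · rw [Valuation.map_mul]; exact mul_le_mul' h01 h10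
    rwa [Valuation.map_mul, Valuation.map_mul, hvD, mul_one] at h
  exact le_of_mul_self_le_mul_self₀ hsq

/-- **`G₁ = (φ₀ φ₁D; φ₁ φ₀) ≡ 1 (mod c)`** entrywise from `|φ₀ − 1|, |φ₁| ≤ |c|` and `|D| ≤ 1`. [cite: Serre1979, Ch. II §1] -/
theorem valued_regRep_sub_one_le {φ₀ φ₁ D c : K} (hφ₀ : Valued.v (φ₀ - 1) ≤ Valued.v c) (hφ₁ : Valued.v φ₁ ≤ Valued.v c) (hvD : Valued.v D ≤ 1) :
    ∀ a b, Valued.v (((!![φ₀, φ₁ * D; φ₁, φ₀] : Matrix (Fin 2) (Fin 2) K) - 1) a b) ≤ Valued.v c := by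
  intro a b
  fin_cases a <;> fin_cases b <;> simp [Matrix.sub_apply]
  · exact hφ₀
  · calc Valued.v φ₁ * Valued.v D ≤ Valued.v c * 1 := mul_le_mul' hφ₁ hvD
      _ = Valued.v c := mul_one _
  · exact hφ₁
  · exact hφ₀

/-- **The endoscopic pattern `(a 0 b; 0 u 0; c 0 d) ≡ 1 (mod c)`** entrywise from the block `(a b; c d) ≡ 1` and `|u − 1| ≤ |c|`. [cite: Rogawski1990, §4.8 Case (a) p. 53] -/
theorem valued_endoPattern_sub_one_le {a b c' d u cc : K}
    (h : ∀ i j, Valued.v (((!![a, b; c', d] : Matrix (Fin 2) (Fin 2) K) - 1) i j) ≤ Valued.v cc) (hu : Valued.v (u - 1) ≤ Valued.v cc) :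
    ∀ i j, Valued.v (((!![a, 0, b; 0, u, 0; c', 0, d] : Matrix (Fin 3) (Fin 3) K) - 1) i j) ≤ Valued.v cc := by
  have h00 := h 0 0
  have h01 := h 0 1
  have h10 := h 1 0
  have h11 := h 1 1
  simp [Matrix.sub_apply] at h00 h01 h10 h11
  intro i j
  fin_cases i <;> fin_cases j <;> simp [Matrix.sub_apply]
  · exact h00
  · exact h01
  · exact hu
  · exact h10
  · exact h11

end Valued

end Literature.NumberTheory.Rogawski1990
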